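import Summits.Ventures.PercRepro.ProfilePointedSeries

/-!
# PercRepro — THE COLOOP LIMIT WHEN `N ≥ 2ρ`: EVERY CAPTURED SET IS A BASIS, `Φ = 0`
(p10, gen 17; `proofs/P10-AVFULL.md` §25(f)(i))

For a finite matroid `M` on `N = #E` elements of rank `ρ` and a point `p`, a captured set `X ∈ 𝒦 = capSets M p` and
its complement are both independent, so `#X ≤ ρ` and `N − #X ≤ ρ`.  Hence if `N ≥ 2ρ` then `N = 2ρ` and `#X = ρ` for
every `X ∈ 𝒦` (or `𝒦 = ∅`): the coloop limit `Φ(M, p) = Σ_{X ∈ 𝒦} (2 #X − N)` vanishes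
(`sum_capSets_signed_of_two_mul_rk_le`) and (C1′) holds with equality (`capLimit_body_of_two_mul_rk_le`).  Together
with the parallel-pair theorem, the `p`-girth regime and the series reduction this is one of the four cases of the
coverage census of §25(g): (C1′) holds on every matroid with at most 6 elements.  Nothing here asserts (C1′) in general.
-/

open scoped Matroid

namespace PercRepro.Cogirth

open Finset ThmH Skew

variable {α : Type} [DecidableEq α] {M : Matroid α} [M.Finite]

/-- A captured set has at most `ρ` elements and its complement too: `#X ≤ ρ` and `N ≤ #X + ρ`. -/
theorem card_le_rk_of_mem_capSets {p : α} {X : Finset α} (hX : X ∈ capSets M p) :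
    X.card ≤ rk M (gr M) ∧ (gr M).card ≤ X.card + rk M (gr M) := by
  obtain ⟨⟨hXb, -⟩, -⟩ := mem_capSets.1 hX
  obtain ⟨hXg, hXr, hXc⟩ := mem_biIndepAll.1 hXb
  have h1 : rk M X ≤ rk M (gr M) := rk_mono' hXg
  have h2 : rk M (gr M \ X) ≤ rk M (gr M) := rk_mono' sdiff_subset
  rw [hXr] at h1
  rw [hXc, card_sdiff_of_subset hXg] at h2
  have h3 : X.card ≤ (gr M).card := card_le_card hXg
  omega

/-- **`N ≥ 2ρ` ⟹ `Φ = 0`**: every captured set is a basis with a basis complement (or `𝒦 = ∅`). -/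
theorem sum_capSets_signed_of_two_mul_rk_le (p : α) (h : 2 * rk M (gr M) ≤ (gr M).card) :
    ∑ X ∈ capSets M p, (2 * (X.card : ℤ) - (gr M).card) = 0 := by
  apply sum_eq_zero
  intro X hX
  obtain ⟨h1, h2⟩ := card_le_rk_of_mem_capSets hX
  have h3 : 2 * X.card = (gr M).card := by omega
  have h4 : ((2 * X.card : ℕ) : ℤ) = ((gr M).card : ℤ) := by exact_mod_cast h3
  push_cast at h4
  linarith

/-- **(C1′) WHEN `N ≥ 2ρ`**, with equality in the body of `CapLimit`. -/
theorem capLimit_body_of_two_mul_rk_le (p : α) (h : 2 * rk M (gr M) ≤ (gr M).card) :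
    (gr M).card * ∑ k ∈ range ((gr M).card + 1), capCount M k p ≤
      2 * ∑ k ∈ range ((gr M).card + 1), k * capCount M k p := by
  rw [capLimit_body_iff_sum_nonneg, sum_capSets_signed_of_two_mul_rk_le p h]

end PercRepro.Cogirth
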